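import Literature.NumberTheory.LFunctions.CardonRobertsLemma35Proofs
import Literature.NumberTheory.LFunctions.RiemannXiHadamardProduct
import HarnessLib

/-!
# RH-EQUIVALENT · The Cardon–Roberts criterion `RH with simple zeros ⟺ p_{2n}(z)/p_{2n}(0) → Ξ(z)/Ξ(0)` DISCHARGED (`CardonRoberts2006_thm_1_holds`) — nothing here bears on the truth of RH

Literature-typing tranche `rh-lit-broughan-2` (Broughan, *Equivalents of the Riemann Hypothesis*
Vol. 2, Thm 6.17; Cardon–Roberts, J. Approx. Theory 138 (2006) 54–64, Theorem 1). This file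
proves the tree's named fact `Literature.NumberTheory.LFunctions.CardonRoberts2006_thm_1`
(`CardonRobertsOrthogonalPolynomials.lean`) from the discharged Lemma 3.5
(`CardonRoberts2006_lemma_3_5_holds`) and the Hadamard product of `Ξ`, exactly as on CR p. 63:

* `Ξ(z) = 8 H₀(2z)` (`riemannXi_eq_deBruijnH`), so for a Hadamard sequence `b` of de Bruijn's
  `H₀` (`exists_isHadamardSeq`, PROVED in the tree from Hadamard's theorem in genus zero)
  `Ξ(z)/Ξ(0) = ∏ₙ (1 + 4bₙ z²)` — CR's "`Ξ(z)/Ξ(0) = ∏_k (1 − z²/ρ_k²)`".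
* (⟹) If every zero of `Ξ` is real and simple, the non-trivial factors are `1 − z²/w_n²` with
  `w_n > 0` running bijectively through the spectrum `S = {a_k}` (injectivity = simplicity, via
  the derivative of the product at a doubled factor), so `Ξ(z)/Ξ(0) = ∏_{a ∈ S} (1 − z²/a²)`,
  the limit in Lemma 3.5.
* (⟸) If `p_{2n}(z)/p_{2n}(0) → Ξ(z)/Ξ(0)` for all `z`, then by Lemma 3.5 and uniqueness of
  limits `Ξ = Ξ(0) ∏_{a∈S}(1 − z²/a²)`; a zero of the product kills a factor, so it is `±a_k`,
  real, and the derivative there is `−(2/a_k) ∏_{j ≠ k} (1 − a_k²/a_j²) · Ξ(0) ≠ 0`.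

§1 is generic calculus of products `∏_i (1 + c_i z²)` with `Σ|c_i| < ∞` (splitting off finitely
many factors, the derivative at a simple and at a repeated vanishing factor).

No new definitions, no named facts (D-0026); standard axioms only; nothing here bears on the
truth of RH.

## References

* [CardonRoberts2006] D. A. Cardon, S. A. Roberts, J. Approx. Theory 138 (2006) 54–64, Theorem 1
  and its proof p. 63.
* [Broughan2017] K. Broughan, *Equivalents of the Riemann Hypothesis* Vol. 2, CUP 2017, Thm 6.17.
-/

noncomputable section

open Complex Filter Topology

namespace Literature.NumberTheory.LFunctions

namespace CardonRobertsCriterion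

/-! ## §1 Calculus of the products `∏_i (1 + c_i z²)` -/

section Products

variable {ι : Type*} {c : ι → ℂ}

/-- Norm summability of the terms `c_i z²`. [folklore] -/
private theorem summable_norm_mul_sq (hc : Summable fun i ↦ ‖c i‖) (z : ℂ) :
    Summable fun i ↦ ‖c i * z ^ 2‖ := by
  simpa [norm_mul, norm_pow] using hc.mul_right (‖z‖ ^ 2)

/-- **Splitting off finitely many factors**:
`∏_i (1 + c_i z²) = ∏_{i ∈ s} (1 + c_i z²) · ∏_{i ∉ s} (1 + c_i z²)`.
[cite: CardonRoberts2006, proof of Theorem 1 p. 63 (the factorisation of `Ξ(z)/Ξ(0)`)] -/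
theorem tprod_eq_prod_mul_tprod (hc : Summable fun i ↦ ‖c i‖) (s : Finset ι) (z : ℂ) :
    ∏' i, (1 + c i * z ^ 2) =
      (∏ i ∈ s, (1 + c i * z ^ 2)) * ∏' i : ↥((s : Set ι)ᶜ), (1 + c i * z ^ 2) := by
  classical
  rw [← Finset.tprod_subtype' s (fun i ↦ 1 + c i * z ^ 2)]
  refine (Multipliable.tprod_mul_tprod_compl (f := fun i ↦ 1 + c i * z ^ 2) (s := (s : Set ι))
    Multipliable.of_finite ?_).symm
  exact multipliable_one_add_of_summable ((summable_norm_mul_sq hc z).subtype _)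

/-- A product all of whose factors are non-zero is non-zero; so a vanishing product has a
vanishing factor. [cite: CardonRoberts2006, proof of Theorem 1 p. 63] -/
theorem exists_factor_eq_zero (hc : Summable fun i ↦ ‖c i‖) {z : ℂ}
    (hz : ∏' i, (1 + c i * z ^ 2) = 0) : ∃ i, 1 + c i * z ^ 2 = 0 := by
  by_contra h
  push Not at h
  exact tprod_one_add_mul_sq_ne_zero hc h hz

/-- A vanishing factor kills the product. [cite: CardonRoberts2006, proof of Theorem 1 p. 63] -/
theorem tprod_eq_zero_of_factor (hc : Summable fun i ↦ ‖c i‖) {z : ℂ} {i : ι}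
    (hi : 1 + c i * z ^ 2 = 0) : ∏' i, (1 + c i * z ^ 2) = 0 := by
  rw [tprod_eq_prod_mul_tprod hc {i} z, Finset.prod_singleton, hi, zero_mul]

/-- The tail product off a finite set is entire. [folklore] -/
private theorem differentiable_tail (hc : Summable fun i ↦ ‖c i‖) (s : Finset ι) :
    Differentiable ℂ fun z ↦ ∏' i : ↥((s : Set ι)ᶜ), (1 + c i * z ^ 2) :=
  differentiable_tprod_one_add_mul_sq (hc.subtype _)

/-- **Derivative at a simple vanishing factor.** If exactly the factor `i₀` vanishes at `z₀`
(`1 + c_{i₀} z₀² = 0`, all other factors non-zero), then the derivative of `∏_i (1 + c_i z²)`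
at `z₀` is `2 c_{i₀} z₀ · ∏_{i ≠ i₀} (1 + c_i z₀²) ≠ 0`.
[cite: CardonRoberts2006, proof of Theorem 1 p. 63 ("the zeros of this product are real and simple")] -/
theorem deriv_tprod_ne_zero_of_simple (hc : Summable fun i ↦ ‖c i‖) {z₀ : ℂ} {i₀ : ι}
    (h0 : 1 + c i₀ * z₀ ^ 2 = 0) (hne : ∀ i, i ≠ i₀ → 1 + c i * z₀ ^ 2 ≠ 0) :
    deriv (fun z ↦ ∏' i, (1 + c i * z ^ 2)) z₀ ≠ 0 := by
  classical
  set T : ℂ → ℂ := fun z ↦ ∏' i : ↥((({i₀} : Finset ι) : Set ι)ᶜ), (1 + c i * z ^ 2) with hT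
  have hF : (fun z ↦ ∏' i, (1 + c i * z ^ 2)) = fun z ↦ (1 + c i₀ * z ^ 2) * T z := by
    funext z
    rw [tprod_eq_prod_mul_tprod hc {i₀} z, Finset.prod_singleton]
  have hTd : DifferentiableAt ℂ T z₀ := (differentiable_tail hc {i₀}) z₀
  have hT0 : T z₀ ≠ 0 := by
    refine tprod_one_add_mul_sq_ne_zero (hc.subtype _) fun i ↦ hne i ?_
    have hi : (i : ι) ∉ (({i₀} : Finset ι) : Set ι) := i.2
    simpa using hi
  have hlin : HasDerivAt (fun z : ℂ ↦ 1 + c i₀ * z ^ 2) (c i₀ * (2 * z₀)) z₀ := by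
    have := ((hasDerivAt_pow 2 z₀).const_mul (c i₀)).const_add 1
    simpa using this
  have hderiv : deriv (fun z ↦ (1 + c i₀ * z ^ 2) * T z) z₀ =
      c i₀ * (2 * z₀) * T z₀ + (1 + c i₀ * z₀ ^ 2) * deriv T z₀ :=
    (hlin.mul hTd.hasDerivAt).deriv
  rw [hF, hderiv, h0, zero_mul, add_zero]
  have hc0 : c i₀ ≠ 0 := by
    intro h; rw [h] at h0; simp at h0
  have hz0 : z₀ ≠ 0 := by
    intro h; rw [h] at h0; simp at h0
  exact mul_ne_zero (mul_ne_zero hc0 (mul_ne_zero two_ne_zero hz0)) hT0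

/-- **Derivative at a repeated vanishing factor.** If two distinct factors `i₁ ≠ i₂` vanish at
`z₀`, the derivative of `∏_i (1 + c_i z²)` at `z₀` is `0`.
[cite: CardonRoberts2006, proof of Theorem 1 p. 63 ("the zeros of this product are real and simple")] -/
theorem deriv_tprod_eq_zero_of_double (hc : Summable fun i ↦ ‖c i‖) {z₀ : ℂ} {i₁ i₂ : ι}
    (hne : i₁ ≠ i₂) (h1 : 1 + c i₁ * z₀ ^ 2 = 0) (h2 : 1 + c i₂ * z₀ ^ 2 = 0) :
    deriv (fun z ↦ ∏' i, (1 + c i * z ^ 2)) z₀ = 0 := by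
  classical
  set T : ℂ → ℂ := fun z ↦ ∏' i : ↥((({i₁, i₂} : Finset ι) : Set ι)ᶜ), (1 + c i * z ^ 2)
    with hT
  have hF : (fun z ↦ ∏' i, (1 + c i * z ^ 2)) =
      fun z ↦ ((1 + c i₁ * z ^ 2) * (1 + c i₂ * z ^ 2)) * T z := by
    funext z
    rw [tprod_eq_prod_mul_tprod hc {i₁, i₂} z, Finset.prod_pair hne]
  have hTd : DifferentiableAt ℂ T z₀ := (differentiable_tail hc {i₁, i₂}) z₀
  have hlin : ∀ j, HasDerivAt (fun z : ℂ ↦ 1 + c j * z ^ 2) (c j * (2 * z₀)) z₀ := fun j ↦ by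
    have := ((hasDerivAt_pow 2 z₀).const_mul (c j)).const_add 1
    simpa using this
  have hderiv : deriv (fun z ↦ (1 + c i₁ * z ^ 2) * (1 + c i₂ * z ^ 2) * T z) z₀ =
      (c i₁ * (2 * z₀) * (1 + c i₂ * z₀ ^ 2) + (1 + c i₁ * z₀ ^ 2) * (c i₂ * (2 * z₀))) * T z₀ +
        (1 + c i₁ * z₀ ^ 2) * (1 + c i₂ * z₀ ^ 2) * deriv T z₀ :=
    (((hlin i₁).mul (hlin i₂)).mul hTd.hasDerivAt).deriv
  rw [hF, hderiv, h1, h2]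
  ring

end Products

/-! ## §2 `Ξ(z) = 8 H₀(2z)` and the Hadamard product of `Ξ` -/

/-- `Ξ(z) = ξ(½ + iz) = 8 H₀(2z)` (`riemannXi_eq_deBruijnH` at `s = ½ + iz`, where
`−i(2s − 1) = 2z`). [cite: CardonRoberts2006, proof of Theorem 1 p. 63] -/
theorem riemannXiUpper_eq_deBruijnH (z : ℂ) : riemannXiUpper z = 8 * deBruijnH 0 (2 * z) := by
  show riemannXi (1 / 2 + I * z) = _
  rw [riemannXi_eq_deBruijnH]
  have hx : xiToH (1 / 2 + I * z) = 2 * z := by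
    have hI : I * I = -1 := I_mul_I
    show -I * (2 * (1 / 2 + I * z) - 1) = 2 * z
    linear_combination (-2 * z) * hI
  rw [hx]

/-- **The Hadamard product of `Ξ`** ("By the Hadamard factorization theorem,
`Ξ(z)/Ξ(0) = ∏_k (1 − z²/ρ_k²)`"): for a Hadamard sequence `b` of `H₀`,
`Ξ(z)/Ξ(0) = ∏ₙ (1 + 4bₙ z²)`. [cite: CardonRoberts2006, proof of Theorem 1 p. 63] -/
theorem xiRatio_eq_tprod {b : ℕ → ℂ} (h : IsHadamardSeq 0 b) (z : ℂ) :
    riemannXiUpper z / riemannXiUpper 0 = ∏' n, (1 + 4 * b n * z ^ 2) := by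
  rw [riemannXiUpper_eq_deBruijnH, riemannXiUpper_eq_deBruijnH, mul_zero,
    mul_div_mul_left _ _ (by norm_num : (8 : ℂ) ≠ 0), ← h.tprod_eq (2 * z)]
  exact tprod_congr fun n ↦ by ring

/-- `Ξ(z) = Ξ(0) ∏ₙ (1 + 4bₙ z²)`. [cite: CardonRoberts2006, proof of Theorem 1 p. 63] -/
theorem riemannXiUpper_eq_mul_tprod {b : ℕ → ℂ} (h : IsHadamardSeq 0 b) (z : ℂ) :
    riemannXiUpper z = riemannXiUpper 0 * ∏' n, (1 + 4 * b n * z ^ 2) := by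
  rw [← xiRatio_eq_tprod h z, mul_div_cancel₀ _ riemannXiUpper_zero_ne_zero]

/-! ## §3 (⟸): if `p_{2n}(z)/p_{2n}(0) → Ξ(z)/Ξ(0)` then the zeros of `Ξ` are real and simple -/

/-- The norms `|−1/a²| = a⁻²` over the spectrum are summable. [cite: CardonRoberts2006, Lemma 3.5 p. 62] -/
theorem summable_norm_spectrumCoeff :
    Summable fun a : cardonRobertsSpectrum ↦ ‖(-1 : ℂ) / ((a : ℝ) : ℂ) ^ 2‖ := by
  refine CardonRobertsAssembly.summable_spectrum_inv_sq.congr fun a ↦ ?_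
  rw [norm_div, norm_neg, norm_one, norm_pow, Complex.norm_real, Real.norm_eq_abs, sq_abs,
    one_div]

/-- The Cardon–Roberts limit in the form `∏_a (1 + c_a z²)`, `c_a = −1/a²`.
[cite: CardonRoberts2006, Lemma 3.5 p. 62] -/
theorem tprod_spectrum_eq (z : ℂ) :
    ∏' a : cardonRobertsSpectrum, (1 - z ^ 2 / ((a : ℝ) : ℂ) ^ 2) =
      ∏' a : cardonRobertsSpectrum, (1 + (-1 : ℂ) / ((a : ℝ) : ℂ) ^ 2 * z ^ 2) :=
  tprod_congr fun a ↦ by ring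

/-- **(⟸) of Theorem 1.** If `p_{2n}(z)/p_{2n}(0) → Ξ(z)/Ξ(0)` for every `z`, then (Lemma 3.5 and
uniqueness of limits) `Ξ = Ξ(0) ∏_{a∈S} (1 − z²/a²)`, so every zero of `Ξ` is `±a_k`, real, and
simple. [cite: CardonRoberts2006, proof of Theorem 1 p. 63] -/
theorem real_simple_of_limit {f : ℂ → ℂ} (hf : IsCardonRobertsWeight f)
    (hlim : ∀ z : ℂ, Tendsto (fun n : ℕ ↦ cardonRobertsEvenRatio (cardonRobertsMeasure f) n z)
      atTop (𝓝 (riemannXiUpper z / riemannXiUpper 0))) :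
    ∀ z : ℂ, riemannXiUpper z = 0 → z.im = 0 ∧ deriv riemannXiUpper z ≠ 0 := by
  obtain ⟨heven, -⟩ := CardonRoberts2006_lemma_3_5_holds f hf
  set c : cardonRobertsSpectrum → ℂ := fun a ↦ (-1 : ℂ) / ((a : ℝ) : ℂ) ^ 2 with hc
  have hcs : Summable fun a ↦ ‖c a‖ := summable_norm_spectrumCoeff
  -- `Ξ(z)/Ξ(0) = P(z)` by uniqueness of limits
  have hPQ : ∀ z, ∏' a : cardonRobertsSpectrum, (1 + c a * z ^ 2) =
      riemannXiUpper z / riemannXiUpper 0 := by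
    intro z
    have h1 := (heven.tendstoLocallyUniformlyOn (s := Set.univ)).tendsto_at (Set.mem_univ z)
    have h2 := tendsto_nhds_unique h1 (hlim z)
    rw [← h2]
    exact (tprod_spectrum_eq z).symm
  have hXi : ∀ z, riemannXiUpper z =
      riemannXiUpper 0 * ∏' a : cardonRobertsSpectrum, (1 + c a * z ^ 2) := by
    intro z
    rw [hPQ z, mul_div_cancel₀ _ riemannXiUpper_zero_ne_zero]
  have hXi' : riemannXiUpper =
      fun z ↦ riemannXiUpper 0 * ∏' a : cardonRobertsSpectrum, (1 + c a * z ^ 2) := funext hXi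
  intro z₁ hz₁
  -- a vanishing factor: `z₁² = a²`
  have hP0 : ∏' a : cardonRobertsSpectrum, (1 + c a * z₁ ^ 2) = 0 := by
    have h := hXi z₁
    rw [hz₁] at h
    exact (mul_eq_zero.1 h.symm).resolve_left riemannXiUpper_zero_ne_zero
  obtain ⟨a, ha⟩ := exists_factor_eq_zero hcs hP0
  have hpos : ∀ a' : cardonRobertsSpectrum, 0 < (a' : ℝ) := fun a' ↦ lt_trans (by norm_num)
    (CardonRobertsAssembly.fourteen_lt_of_mem_spectrum a'.2)
  have hca : ∀ a' : cardonRobertsSpectrum, c a' * ((a' : ℝ) : ℂ) ^ 2 = -1 := by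
    intro a'
    have ha0 : ((a' : ℝ) : ℂ) ≠ 0 := by exact_mod_cast (hpos a').ne'
    simp only [hc]
    field_simp
  have hcne : ∀ a' : cardonRobertsSpectrum, c a' ≠ 0 := by
    intro a' h0
    have := hca a'
    rw [h0, zero_mul] at this
    norm_num at this
  have hsq_of : ∀ a' : cardonRobertsSpectrum, 1 + c a' * z₁ ^ 2 = 0 →
      z₁ ^ 2 = ((a' : ℝ) : ℂ) ^ 2 := by
    intro a' h0
    have e : c a' * (z₁ ^ 2 - ((a' : ℝ) : ℂ) ^ 2) = 0 := by linear_combination h0 - hca a'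
    exact sub_eq_zero.1 ((mul_eq_zero.1 e).resolve_left (hcne a'))
  have hapos : 0 < (a : ℝ) := hpos a
  have hsq : z₁ ^ 2 = ((a : ℝ) : ℂ) ^ 2 := hsq_of a ha
  refine ⟨?_, ?_⟩
  · rcases sq_eq_sq_iff_eq_or_eq_neg.1 hsq with h | h
    · rw [h]; simp
    · rw [h]; simp
  · -- simplicity: only the factor `a` vanishes at `z₁`
    have hne : ∀ a' : cardonRobertsSpectrum, a' ≠ a → 1 + c a' * z₁ ^ 2 ≠ 0 := by
      intro a' ha' h0
      have ha'pos : 0 < (a' : ℝ) := hpos a'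
      have hsq' : z₁ ^ 2 = ((a' : ℝ) : ℂ) ^ 2 := hsq_of a' h0
      have h3 : ((a' : ℝ) : ℂ) ^ 2 = ((a : ℝ) : ℂ) ^ 2 := by rw [← hsq', hsq]
      have h4 : (a' : ℝ) ^ 2 = (a : ℝ) ^ 2 := by exact_mod_cast h3
      have h5 : (a' : ℝ) = (a : ℝ) := by nlinarith [ha'pos, hapos]
      exact ha' (Subtype.ext h5)
    have hD := deriv_tprod_ne_zero_of_simple hcs ha hne
    rw [hXi', deriv_const_mul _ ((differentiable_tprod_one_add_mul_sq hcs) z₁)]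
    exact mul_ne_zero riemannXiUpper_zero_ne_zero hD

/-! ## §4 (⟹): if the zeros of `Ξ` are real and simple then `Ξ(z)/Ξ(0) = ∏_{a∈S}(1 − z²/a²)` -/

/-- **(⟹) of Theorem 1.** If every zero of `Ξ` is real and simple, then the Hadamard product
`Ξ(z)/Ξ(0) = ∏ₙ (1 + 4bₙz²)` is `∏_{a ∈ S} (1 − z²/a²)` — the non-trivial factors are
`1 − z²/wₙ²`, `wₙ > 0` a zero, and `n ↦ wₙ` is a bijection onto the spectrum (injective by
simplicity) — so `p_{2n}(z)/p_{2n}(0) → Ξ(z)/Ξ(0)` by Lemma 3.5.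
[cite: CardonRoberts2006, proof of Theorem 1 p. 63] -/
theorem limit_of_real_simple {f : ℂ → ℂ} (hf : IsCardonRobertsWeight f)
    (hRS : ∀ z : ℂ, riemannXiUpper z = 0 → z.im = 0 ∧ deriv riemannXiUpper z ≠ 0) :
    ∀ z : ℂ, Tendsto (fun n : ℕ ↦ cardonRobertsEvenRatio (cardonRobertsMeasure f) n z)
      atTop (𝓝 (riemannXiUpper z / riemannXiUpper 0)) := by
  classical
  obtain ⟨heven, -⟩ := CardonRoberts2006_lemma_3_5_holds f hf
  obtain ⟨b, h⟩ := exists_isHadamardSeq 0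
  set c : ℕ → ℂ := fun n ↦ 4 * b n with hc
  have hcs : Summable fun n ↦ ‖c n‖ := by
    have := h.summable.mul_left 4
    simpa [hc, norm_mul] using this
  have hQ : ∀ z, riemannXiUpper z / riemannXiUpper 0 = ∏' n, (1 + c n * z ^ 2) :=
    xiRatio_eq_tprod h
  have hXi : ∀ z, riemannXiUpper z = riemannXiUpper 0 * ∏' n, (1 + c n * z ^ 2) :=
    riemannXiUpper_eq_mul_tprod h
  have hXi' : riemannXiUpper = fun z ↦ riemannXiUpper 0 * ∏' n, (1 + c n * z ^ 2) := funext hXi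
  have hzero : ∀ {z : ℂ} {n : ℕ}, 1 + c n * z ^ 2 = 0 → riemannXiUpper z = 0 := by
    intro z n hn
    rw [hXi z, tprod_eq_zero_of_factor hcs hn, mul_zero]
  -- a root `rₙ` of the `n`-th factor, real by hypothesis; `wₙ = |Re rₙ| > 0`
  set r : ℕ → ℂ := fun n ↦ (-1 / c n) ^ (((2 : ℕ) : ℂ)⁻¹) with hr
  have hr2 : ∀ n, r n ^ 2 = -1 / c n := fun n ↦ Complex.cpow_nat_inv_pow _ two_ne_zero
  have hfac_r : ∀ n, c n ≠ 0 → 1 + c n * r n ^ 2 = 0 := by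
    intro n hn
    rw [hr2]
    field_simp
    ring
  have hr_im : ∀ n, c n ≠ 0 → (r n).im = 0 := fun n hn ↦ (hRS _ (hzero (hfac_r n hn))).1
  have hr_ne : ∀ n, c n ≠ 0 → r n ≠ 0 := by
    intro n hn h0
    have := hfac_r n hn
    rw [h0] at this
    simp at this
  have hr_eq : ∀ n, c n ≠ 0 → r n = (((r n).re : ℝ) : ℂ) := fun n hn ↦
    Complex.ext (by simp) (by simp [hr_im n hn])
  set w : ℕ → ℝ := fun n ↦ |(r n).re| with hw
  have hw_sq : ∀ n, c n ≠ 0 → ((w n : ℝ) : ℂ) ^ 2 = r n ^ 2 := by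
    intro n hn
    have h1 : (w n) ^ 2 = ((r n).re) ^ 2 := by rw [hw]; exact sq_abs _
    calc ((w n : ℝ) : ℂ) ^ 2 = (((w n) ^ 2 : ℝ) : ℂ) := by push_cast; ring
      _ = ((((r n).re) ^ 2 : ℝ) : ℂ) := by rw [h1]
      _ = (((r n).re : ℝ) : ℂ) ^ 2 := by push_cast; ring
      _ = r n ^ 2 := by rw [← hr_eq n hn]
  have hw_pos : ∀ n, c n ≠ 0 → 0 < w n := by
    intro n hn
    rw [hw]
    refine abs_pos.2 fun h0 ↦ hr_ne n hn ?_
    rw [hr_eq n hn, h0]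
    simp
  have hfac_w : ∀ n, c n ≠ 0 → ∀ z : ℂ, 1 + c n * z ^ 2 = 1 - z ^ 2 / ((w n : ℝ) : ℂ) ^ 2 := by
    intro n hn z
    rw [hw_sq n hn, hr2 n]
    field_simp
    ring
  have hw_fac : ∀ n, c n ≠ 0 → 1 + c n * ((w n : ℝ) : ℂ) ^ 2 = 0 := by
    intro n hn
    rw [hw_sq n hn]
    exact hfac_r n hn
  have hw_zero : ∀ n, c n ≠ 0 → riemannXiUpper (w n) = 0 := fun n hn ↦ hzero (hw_fac n hn)
  have hw_mem : ∀ n, c n ≠ 0 → (w n : ℝ) ∈ cardonRobertsSpectrum := fun n hn ↦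
    ⟨(w n : ℂ), ⟨hw_zero n hn, by simpa using hw_pos n hn⟩, by simp⟩
  -- the bijection `{n : cₙ ≠ 0} → S`, `n ↦ wₙ`
  set N : Set ℕ := {n | c n ≠ 0} with hN
  set φ : N → cardonRobertsSpectrum := fun n ↦ ⟨w n, hw_mem n n.2⟩ with hφ
  have hφ_inj : Function.Injective φ := by
    intro n m hnm
    by_contra hne
    have hne' : (n : ℕ) ≠ m := fun e ↦ hne (Subtype.ext e)
    have hwn : w n = w m := congrArg Subtype.val hnm
    have h1 : 1 + c n * ((w n : ℝ) : ℂ) ^ 2 = 0 := hw_fac n n.2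
    have h2 : 1 + c m * ((w n : ℝ) : ℂ) ^ 2 = 0 := by rw [hwn]; exact hw_fac m m.2
    have hD := deriv_tprod_eq_zero_of_double hcs hne' h1 h2
    have hder : deriv riemannXiUpper (w n) = 0 := by
      rw [hXi', deriv_const_mul _ ((differentiable_tprod_one_add_mul_sq hcs) _), hD, mul_zero]
    exact (hRS _ (hw_zero n n.2)).2 hder
  have hφ_surj : Function.Surjective φ := by
    rintro ⟨a, z, hz, hza⟩
    have hzim : z.im = 0 := (hRS z hz.1).1
    have hza' : z = ((a : ℝ) : ℂ) := Complex.ext (by simp [hza]) (by simp [hzim])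
    have hXa : riemannXiUpper a = 0 := by rw [← hza']; exact hz.1
    have hprod0 : ∏' k, (1 + c k * ((a : ℝ) : ℂ) ^ 2) = 0 := by
      have h0 := hXi a
      rw [hXa] at h0
      exact (mul_eq_zero.1 h0.symm).resolve_left riemannXiUpper_zero_ne_zero
    obtain ⟨n, hn⟩ := exists_factor_eq_zero hcs hprod0
    have hcn : c n ≠ 0 := by
      intro h0; rw [h0] at hn; simp at hn
    refine ⟨⟨n, hcn⟩, Subtype.ext ?_⟩
    have ha0 : 0 < a := by rw [← hza]; exact hz.2
    have h1 : ((w n : ℝ) : ℂ) ^ 2 = ((a : ℝ) : ℂ) ^ 2 := by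
      have e : c n * (((w n : ℝ) : ℂ) ^ 2 - ((a : ℝ) : ℂ) ^ 2) = 0 := by
        linear_combination hw_fac n hcn - hn
      exact sub_eq_zero.1 ((mul_eq_zero.1 e).resolve_left hcn)
    have h2 : (w n) ^ 2 = a ^ 2 := by exact_mod_cast h1
    show w n = a
    nlinarith [hw_pos n hcn, ha0, h2]
  -- conclusion: `P = Ξ/Ξ(0)`
  intro z
  have h1 := (heven.tendstoLocallyUniformlyOn (s := Set.univ)).tendsto_at (Set.mem_univ z)
  have hPQ : ∏' a : cardonRobertsSpectrum, (1 - z ^ 2 / ((a : ℝ) : ℂ) ^ 2) =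
      riemannXiUpper z / riemannXiUpper 0 := by
    rw [hQ z, ← (Equiv.ofBijective φ ⟨hφ_inj, hφ_surj⟩).tprod_eq
      (fun a : cardonRobertsSpectrum ↦ 1 - z ^ 2 / ((a : ℝ) : ℂ) ^ 2)]
    have e : ∀ m : N, (fun a : cardonRobertsSpectrum ↦ 1 - z ^ 2 / ((a : ℝ) : ℂ) ^ 2)
        (Equiv.ofBijective φ ⟨hφ_inj, hφ_surj⟩ m) = 1 + c m * z ^ 2 := by
      intro m
      simp only [Equiv.ofBijective_apply, hφ]
      exact (hfac_w m m.2 z).symm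
    rw [tprod_congr e]
    exact tprod_subtype_eq_of_mulSupport_subset (s := N) (f := fun n ↦ 1 + c n * z ^ 2)
      fun n hn ↦ by
        simp only [Function.mem_mulSupport] at hn
        intro h0
        apply hn
        show 1 + c n * z ^ 2 = 1
        rw [show c n = 0 from by simpa [hN] using h0]
        ring
  rw [← hPQ]
  exact h1

end CardonRobertsCriterion

/-! ## §5 The criterion -/

open CardonRobertsCriterion in
/-- **Cardon–Roberts 2006, Theorem 1 — DISCHARGED** (Broughan Vol. 2 Thm 6.17): for every
admissible `f`, "the Riemann Hypothesis with simple zeros is true" (every zero of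
`Ξ(z) = ξ(½ + iz)` real and simple) "if and only if `lim p_{2n}(z)/p_{2n}(0) = ξ(½+iz)/ξ(½)` for
every `z ∈ ℂ`". From Lemma 3.5 (`CardonRoberts2006_lemma_3_5_holds`) and the Hadamard product of
`Ξ` as on CR p. 63. RH-EQUIVALENT (a proved equivalence; nothing here bears on the truth of RH).
[cite: CardonRoberts2006, Theorem 1 p. 55 and its proof p. 63; Broughan2017, Vol. 2 Thm 6.17] -/
theorem CardonRoberts2006_thm_1_holds : CardonRoberts2006_thm_1 := fun _ hf ↦
  ⟨limit_of_real_simple hf, real_simple_of_limit hf⟩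

end Literature.NumberTheory.LFunctions

end
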